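import Summits.NavierStokesRegularity.NavierStokesRegularity.Theorems.ExtremiserTransienceDissipationLedgerDefs
import HarnessLib

/-!
# LINE g10-α «dissipation ledger» (crux 26567): L3, the ledger count — PORT of the author's in-file proof

Helper file for the crux `NearExtremalTransiencePerFlow` (stmt-NavierStokesRegularity-26567), LINE g10-α `dissipation_ledger`
(`Cruxes/NearExtremalTransiencePerFlow/Lines/dissipation_ledger.lean`, planner ns-idea-5 g10).  `ledgerCount_holds : LedgerCount` — the
elementary packing lemma L3, PROVED in the crux workfile by the author and ported here VERBATIM (statement = the texts of record
`…DissipationLedger.LedgerCount`; `E3` spelled out) so that it is an importable tree theorem.  Port by prover seat ns-net-p2 (g10); proof: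
planner ns-idea-5 g10.

HONEST FRAMING: a packing lemma about a measure on `ℝ × ℝ³`; nothing about Navier–Stokes regularity or blow-up is proved; no summit is
proved by a line. [folklore]
-/

noncomputable section

open scoped Topology InnerProductSpace RealInnerProductSpace ENNReal ContDiff
open MeasureTheory Filter Set Metric Function
open Literature.Analysis Literature.Analysis.FluidPDE
open Summit.NavierStokesRegularity.NavierStokesRegularity.Theorems

namespace Summit.NavierStokesRegularity.NavierStokesRegularity.Theorems

set_option linter.dupNamespace false

namespace NearExtremalTransiencePerFlow.DissipationLedger

set_option maxHeartbeats 1600000 in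
/-- **L3 is a THEOREM** (elementary packing, kernel-checked; no `sorry`): the ledger arithmetic of the line. -/
theorem ledgerCount_holds : LedgerCount := by
  intro μ P s g ρ c D a E hs hg hρ hc hD ha ha1 hU hPer hSp hBud
  -- ### scales: `L0 = √(-s)`, epoch lengths `L k = 6^k L0`, epoch times `τ k = 36^k s`
  obtain ⟨L0, hL0⟩ : ∃ L0 : ℝ, L0 = Real.sqrt (-s) := ⟨_, rfl⟩
  have hL0pos : 0 < L0 := by rw [hL0]; exact Real.sqrt_pos.2 (neg_pos.2 hs)
  have hL0sq : L0 ^ 2 = -s := by rw [hL0]; exact Real.sq_sqrt (neg_pos.2 hs).le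
  obtain ⟨L, hL⟩ : ∃ L : ℕ → ℝ, ∀ k, L k = 6 ^ k * L0 := ⟨_, fun _ => rfl⟩
  obtain ⟨τ, hτ⟩ : ∃ τ : ℕ → ℝ, ∀ k, τ k = 36 ^ k * s := ⟨_, fun _ => rfl⟩
  have hLpos : ∀ k, 0 < L k := fun k => by rw [hL]; positivity
  have hτneg : ∀ k, τ k < 0 := fun k => by rw [hτ]; exact mul_neg_of_pos_of_neg (by positivity) hs
  have h36 : ∀ k : ℕ, (36 : ℝ) ^ k = (6 ^ k) ^ 2 := fun k => by
    rw [← pow_mul, mul_comm, pow_mul]; norm_num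
  have hsqrtτ : ∀ k, Real.sqrt (-(τ k)) = L k := by
    intro k
    rw [hτ, hL, hL0, show -(36 ^ k * s) = ((6 : ℝ) ^ k) ^ 2 * (-s) by rw [h36]; ring,
      Real.sqrt_mul (sq_nonneg _), Real.sqrt_sq (by positivity)]
  have hLsq : ∀ k, L k ^ 2 = -(τ k) := fun k => by
    rw [hL, hτ, mul_pow, ← h36, hL0sq]; ring
  have hLmono : ∀ {k k' : ℕ}, k ≤ k' → L k ≤ L k' := by
    intro k k' hkk'
    rw [hL, hL]
    exact mul_le_mul_of_nonneg_right (pow_le_pow_right₀ (by norm_num) hkk') hL0pos.le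
  have hL0le : ∀ k, L0 ≤ L k := fun k => by
    have h0 : L 0 = L0 := by rw [hL]; simp
    rw [← h0]; exact hLmono (Nat.zero_le k)
  have hτmono : ∀ {k k' : ℕ}, k ≤ k' → τ k' ≤ τ k := by
    intro k k' hkk'
    rw [hτ, hτ]
    exact mul_le_mul_of_nonpos_right (pow_le_pow_right₀ (by norm_num) hkk') hs.le
  have hτles : ∀ k, τ k ≤ s := fun k => by
    rw [hτ]; exact mul_le_of_one_le_left hs.le (one_le_pow₀ (by norm_num))
  -- ### iterated backward propagation with parabolic drift `≤ ρ L k`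
  have hiter : ∀ (k : ℕ) (z : (EuclideanSpace ℝ (Fin 3))), P s z → ∃ x : (EuclideanSpace ℝ (Fin 3)), ‖x - z‖ ≤ ρ * L k ∧ P (τ k) x := by
    intro k
    induction k with
    | zero =>
      intro z hz
      refine ⟨z, ?_, ?_⟩
      · rw [sub_self, norm_zero]; exact (mul_pos hρ (hLpos 0)).le
      · rw [hτ]; simpa using hz
    | succ k ih =>
      intro z hz
      obtain ⟨x, hxz, hPx⟩ := ih z hz
      obtain ⟨x', hx'x, hPx'⟩ := hPer (τ k) x (hτneg k) hPx
      refine ⟨x', ?_, ?_⟩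
      · rw [hsqrtτ k] at hx'x
        have h6 : L (k + 1) = 6 * L k := by rw [hL, hL, pow_succ]; ring
        calc ‖x' - z‖ ≤ ‖x' - x‖ + ‖x - z‖ := norm_sub_le_norm_sub_add_norm_sub _ _ _
          _ ≤ ρ * L k + ρ * L k := add_le_add hx'x hxz
          _ ≤ ρ * L (k + 1) := by rw [h6]; nlinarith [hLpos k, hρ]
      · have e : 36 * τ k = τ (k + 1) := by rw [hτ, hτ, pow_succ]; ring
        rw [← e]; exact hPx'
  -- ### spacings `σ k`, the comparison constant `Γ`, the number of epochs `k₁`, the radius `R₀`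
  obtain ⟨σ, hσ⟩ : ∃ σ : ℕ → ℝ, ∀ k, σ k = 2 * g + 2 * ρ * L k + 2 * D * L k := ⟨_, fun _ => rfl⟩
  have hσpos : ∀ k, 0 < σ k := fun k => by rw [hσ]; nlinarith [hLpos k, hρ, hD]
  obtain ⟨E', hE'0, hEE'⟩ : ∃ E' : ℝ, 0 ≤ E' ∧ E ≤ E' := ⟨max E 0, le_max_right _ _, le_max_left _ _⟩
  obtain ⟨Γ, hΓ⟩ : ∃ Γ : ℝ, Γ = 2 * g / L0 + 2 * ρ + 2 * D := ⟨_, rfl⟩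
  have hΓpos : 0 < Γ := by rw [hΓ]; positivity
  have hσΓ : ∀ k, σ k ≤ Γ * L k := by
    intro k
    have h1 : 2 * g ≤ 2 * g / L0 * L k := by
      rw [div_mul_eq_mul_div, le_div_iff₀ hL0pos]
      exact mul_le_mul_of_nonneg_left (hL0le k) (by positivity)
    rw [hσ, hΓ]; nlinarith [h1, hLpos k]
  obtain ⟨k₁, hk₁⟩ : ∃ k₁ : ℕ, Γ * (E' + 1) / c ≤ (k₁ : ℝ) := ⟨_, Nat.le_ceil _⟩
  have hcoef : (E' + 1) * Γ ≤ ((k₁ : ℝ) + 1) * c := by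
    have h1 := (div_le_iff₀ hc).1 hk₁
    nlinarith [hc, hΓpos, hE'0]
  obtain ⟨R₀, hR₀⟩ : ∃ R₀ : ℝ, R₀ = σ 0 + E' * g + (E' * (ρ + D + 2) + ((k₁ : ℝ) + 1) * c) * L k₁ + 1 :=
    ⟨_, rfl⟩
  have hR₀A : 0 ≤ (E' * (ρ + D + 2) + ((k₁ : ℝ) + 1) * c) * L k₁ :=
    mul_nonneg (by positivity) (hLpos k₁).le
  have hR₀B : 0 ≤ E' * g := mul_nonneg hE'0 hg
  have hR₀pos : 0 < R₀ := by
    rw [hR₀]; linarith [hσpos 0, hR₀A, hR₀B]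
  have hR₀σ : σ 0 ≤ R₀ := by
    rw [hR₀]; linarith [hR₀A, hR₀B]
  obtain ⟨m, hm⟩ : ∃ m : ℕ → ℕ, ∀ k, m k = ⌊R₀ / σ k⌋₊ := ⟨_, fun _ => rfl⟩
  have hmle : ∀ k, (m k : ℝ) ≤ R₀ / σ k := fun k => by
    rw [hm]; exact Nat.floor_le (div_nonneg hR₀pos.le (hσpos k).le)
  have hmge : ∀ k, R₀ / σ k - 1 ≤ (m k : ℝ) := fun k => by
    rw [hm]; exact (Nat.sub_one_lt_floor _).le
  obtain ⟨R, hR⟩ : ∃ R : ℝ, R = R₀ + g + (ρ + D + 2) * L k₁ := ⟨_, rfl⟩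
  have hRpos : 0 < R := by rw [hR]; nlinarith [hLpos k₁, hρ, hD]
  -- ### points near the spheres at time `s` and their propagated level points at the epochs
  have hz : ∀ (k i : ℕ), ∃ z : (EuclideanSpace ℝ (Fin 3)), |‖z‖ - i * σ k| ≤ g ∧ P s z := fun k i =>
    hU (i * σ k) (mul_nonneg (Nat.cast_nonneg i) (hσpos k).le)
  choose z hzr hzP using hz
  have hx : ∀ (k i : ℕ), ∃ x : (EuclideanSpace ℝ (Fin 3)), ‖x - z k i‖ ≤ ρ * L k ∧ P (τ k) x := fun k i => hiter k (z k i) (hzP k i)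
  choose x hxz hxP using hx
  -- ### the boxes
  obtain ⟨B, hB⟩ : ∃ B : ℕ → ℕ → Set (ℝ × (EuclideanSpace ℝ (Fin 3))),
      ∀ k i, B k i = Set.Icc ((1 + a) * τ k) (τ k) ×ˢ Metric.ball (x k i) (D * L k) := ⟨_, fun _ _ => rfl⟩
  have hBmeas : ∀ k i, MeasurableSet (B k i) := fun k i => by
    rw [hB]; exact measurableSet_Icc.prod measurableSet_ball
  have hBspend : ∀ k i, ENNReal.ofReal (c * L k) ≤ μ (B k i) := by
    intro k i
    have h := hSp (τ k) (x k i) (hτneg k) (hxP k i)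
    rw [hsqrtτ k] at h
    rw [hB]; exact h
  -- separation within an epoch
  have hsep : ∀ k i i', i < i' → Disjoint (Metric.ball (x k i) (D * L k)) (Metric.ball (x k i') (D * L k)) := by
    intro k i i' hii'
    apply Metric.ball_disjoint_ball
    have hi : (i : ℝ) + 1 ≤ i' := by exact_mod_cast hii'
    have h1 := abs_le.1 (hzr k i)
    have h2 := abs_le.1 (hzr k i')
    have hzz : σ k - 2 * g ≤ ‖z k i' - z k i‖ := by
      have h3 := norm_sub_norm_le (z k i') (z k i)
      nlinarith [h1.2, h2.1, hσpos k]
    have hxx : ‖z k i' - z k i‖ ≤ ‖x k i' - x k i‖ + ρ * L k + ρ * L k := by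
      have e : z k i' - z k i = (x k i' - x k i) - (x k i' - z k i') + (x k i - z k i) := by abel
      rw [e]
      calc ‖(x k i' - x k i) - (x k i' - z k i') + (x k i - z k i)‖
          ≤ ‖(x k i' - x k i) - (x k i' - z k i')‖ + ‖x k i - z k i‖ := norm_add_le _ _
        _ ≤ ‖x k i' - x k i‖ + ‖x k i' - z k i'‖ + ‖x k i - z k i‖ := by
            gcongr; exact norm_sub_le _ _
        _ ≤ _ := by linarith [hxz k i, hxz k i']
    rw [dist_eq_norm, norm_sub_rev]
    have e := hσ k
    linarith
  -- separation of the time intervals across epochs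
  have htime : ∀ k k', k < k' → Disjoint (Set.Icc ((1 + a) * τ k) (τ k)) (Set.Icc ((1 + a) * τ k') (τ k')) := by
    intro k k' hkk'
    rw [Set.disjoint_left]
    intro p hp hp'
    have h1 : τ k' ≤ 36 * τ k := by
      have e : 36 * τ k = τ (k + 1) := by rw [hτ, hτ, pow_succ]; ring
      rw [e]; exact hτmono (Nat.succ_le_of_lt hkk')
    have h2 : 36 * τ k < (1 + a) * τ k := by nlinarith [hτneg k]
    linarith [hp.1, hp'.2, h1, h2]
  -- ### the index set: epochs `k ≤ k₁`, sphere indices `i < m k`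
  obtain ⟨I, hI⟩ : ∃ I : Finset ((_ : ℕ) × ℕ), I = (Finset.range (k₁ + 1)).sigma fun k => Finset.range (m k) :=
    ⟨_, rfl⟩
  have hmemI : ∀ p ∈ I, p.1 ≤ k₁ ∧ p.2 < m p.1 := by
    intro p hp
    rw [hI, Finset.mem_sigma, Finset.mem_range, Finset.mem_range] at hp
    exact ⟨Nat.le_of_lt_succ hp.1, hp.2⟩
  have hpd : Set.PairwiseDisjoint (↑I : Set ((_ : ℕ) × ℕ)) (fun p => B p.1 p.2) := by
    intro p _ q _ hpq
    obtain ⟨k, i⟩ := p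
    obtain ⟨k', i'⟩ := q
    show Disjoint (B k i) (B k' i')
    rw [hB, hB, Set.disjoint_prod]
    rcases lt_trichotomy k k' with hlt | heq | hgt
    · exact Or.inl (htime k k' hlt)
    · subst heq
      right
      rcases lt_trichotomy i i' with hlt' | heq' | hgt'
      · exact hsep k i i' hlt'
      · exact absurd (by subst heq'; rfl) hpq
      · exact (hsep k i' i hgt').symm
    · exact Or.inl (htime k' k hgt).symm
  -- ### every box lies in the big cylinder `[(1+a) τ k₁, s] × B(0, R)`
  have hBsub : ∀ p ∈ I, B p.1 p.2 ⊆ Set.Icc ((1 + a) * τ k₁) s ×ˢ Metric.ball (0 : (EuclideanSpace ℝ (Fin 3))) R := by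
    intro p hp
    obtain ⟨hk, hi⟩ := hmemI p hp
    rw [hB]
    refine Set.prod_mono (Set.Icc_subset_Icc ?_ (hτles _)) ?_
    · exact mul_le_mul_of_nonneg_left (hτmono hk) (by linarith)
    · apply Metric.ball_subset_ball'
      rw [dist_eq_norm, sub_zero]
      have h1 := abs_le.1 (hzr p.1 p.2)
      have hiσ : (p.2 : ℝ) * σ p.1 ≤ R₀ := by
        have h2 : (p.2 : ℝ) ≤ m p.1 := by exact_mod_cast hi.le
        have h3 := hmle p.1
        rw [le_div_iff₀ (hσpos _)] at h3
        nlinarith [hσpos p.1]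
      have hxle : ‖x p.1 p.2‖ ≤ ‖x p.1 p.2 - z p.1 p.2‖ + ‖z p.1 p.2‖ := norm_le_norm_sub_add _ _
      have hLk := hLmono hk
      rw [hR]
      nlinarith [hxz p.1 p.2, h1.2, hD, hρ, hLpos p.1]
  -- ### the ledger inequality in `ℝ≥0∞`, then in `ℝ`
  have hτ1s : (1 + a) * τ k₁ < s := by
    have h1 : (1 + a) * τ k₁ < τ k₁ := by nlinarith [hτneg k₁]
    exact h1.trans_le (hτles k₁)
  have hτR : -((1 + a) * τ k₁) ≤ R ^ 2 := by
    have h1 : -((1 + a) * τ k₁) = (1 + a) * L k₁ ^ 2 := by rw [hLsq]; ring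
    have h2 : 2 * L k₁ ≤ R := by
      have h3 : 0 ≤ (ρ + D) * L k₁ := mul_nonneg (by linarith) (hLpos k₁).le
      have h4 : (ρ + D + 2) * L k₁ = (ρ + D) * L k₁ + 2 * L k₁ := by ring
      rw [hR]; linarith [hLpos k₁, hR₀pos, hg, h3, h4]
    have h3 : (2 * L k₁) ^ 2 ≤ R ^ 2 := pow_le_pow_left₀ (by linarith [hLpos k₁]) h2 2
    have h4 : (1 + a) * L k₁ ^ 2 ≤ (2 * L k₁) ^ 2 := by
      rw [show (2 * L k₁) ^ 2 = 4 * L k₁ ^ 2 by ring]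
      exact mul_le_mul_of_nonneg_right (by linarith) (sq_nonneg _)
    rw [h1]; linarith
  have key : ENNReal.ofReal (∑ p ∈ I, c * L p.1) ≤ ENNReal.ofReal (E' * R) := by
    calc ENNReal.ofReal (∑ p ∈ I, c * L p.1)
        = ∑ p ∈ I, ENNReal.ofReal (c * L p.1) :=
          ENNReal.ofReal_sum_of_nonneg fun p _ => (mul_pos hc (hLpos _)).le
      _ ≤ ∑ p ∈ I, μ (B p.1 p.2) := Finset.sum_le_sum fun p _ => hBspend p.1 p.2
      _ = μ (⋃ p ∈ I, B p.1 p.2) := (measure_biUnion_finset hpd fun p _ => hBmeas p.1 p.2).symm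
      _ ≤ μ (Set.Icc ((1 + a) * τ k₁) s ×ˢ Metric.ball (0 : (EuclideanSpace ℝ (Fin 3))) R) :=
          measure_mono (Set.iUnion₂_subset fun p hp => hBsub p hp)
      _ ≤ ENNReal.ofReal (E * R) := hBud R _ _ hRpos hτ1s hs hτR
      _ ≤ ENNReal.ofReal (E' * R) := ENNReal.ofReal_le_ofReal (mul_le_mul_of_nonneg_right hEE' hRpos.le)
  have hS : ∑ p ∈ I, c * L p.1 = ∑ k ∈ Finset.range (k₁ + 1), (m k : ℝ) * (c * L k) := by
    rw [hI, Finset.sum_sigma]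
    refine Finset.sum_congr rfl fun k _ => ?_
    show ∑ i ∈ Finset.range (m k), c * L k = _
    rw [Finset.sum_const, Finset.card_range, nsmul_eq_mul]
  -- per-epoch spending `≥ c R₀/Γ - c L k₁`
  have hep : ∀ k ∈ Finset.range (k₁ + 1), c * R₀ / Γ - c * L k₁ ≤ (m k : ℝ) * (c * L k) := by
    intro k hk
    have hk' : k ≤ k₁ := Nat.le_of_lt_succ (Finset.mem_range.1 hk)
    have h1 : R₀ / (Γ * L k) ≤ R₀ / σ k := div_le_div_of_nonneg_left hR₀pos.le (hσpos k) (hσΓ k)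
    have h2 := hmge k
    have h3 : R₀ / (Γ * L k) * (c * L k) = c * R₀ / Γ := by
      field_simp [(hLpos k).ne', hΓpos.ne']
    have h4 : (R₀ / (Γ * L k) - 1) * (c * L k) ≤ (m k : ℝ) * (c * L k) :=
      mul_le_mul_of_nonneg_right (by linarith) (mul_pos hc (hLpos k)).le
    have h5 := hLmono hk'
    nlinarith [h3, h4, hc]
  have hSge : ((k₁ : ℝ) + 1) * (c * R₀ / Γ - c * L k₁) ≤ ∑ p ∈ I, c * L p.1 := by
    rw [hS]
    have h := Finset.sum_le_sum hep
    rw [Finset.sum_const, Finset.card_range, nsmul_eq_mul] at h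
    push_cast at h
    linarith
  -- the contradiction
  have hfin : ∑ p ∈ I, c * L p.1 ≤ E' * R ∨ ∑ p ∈ I, c * L p.1 ≤ 0 := ENNReal.ofReal_le_ofReal_iff'.1 key
  have hgap : E' * R < ((k₁ : ℝ) + 1) * (c * R₀ / Γ - c * L k₁) := by
    have h1 : (E' + 1) * R₀ ≤ ((k₁ : ℝ) + 1) * (c * R₀ / Γ) := by
      have h2 : ((k₁ : ℝ) + 1) * (c * R₀ / Γ) = ((k₁ : ℝ) + 1) * c / Γ * R₀ := by ring
      rw [h2]
      refine mul_le_mul_of_nonneg_right ?_ hR₀pos.le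
      rw [le_div_iff₀ hΓpos]; exact hcoef
    rw [hR]
    have h3 : R₀ = σ 0 + E' * g + (E' * (ρ + D + 2) + ((k₁ : ℝ) + 1) * c) * L k₁ + 1 := hR₀
    nlinarith [h1, hσpos 0, hE'0, hLpos k₁]
  have hERnn : 0 ≤ E' * R := mul_nonneg hE'0 hRpos.le
  rcases hfin with h | h <;> linarith

end NearExtremalTransiencePerFlow.DissipationLedger

end Summit.NavierStokesRegularity.NavierStokesRegularity.Theorems

end
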